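import Summits.AtomisticToContinuum.HydrodynamicLimit.Theorems.CollisionIsometryCLTCollisionalTransferLocalityFluxForm
import HarnessLib

/-!
# [A'-kin], part 3: the oscillation of the collision-jump sum is dominated by the virial increments
(line `hemisphere-affine-slaving`, crux `CollisionalTransferLocality`, stmt-AtomisticToContinuum-9518)

Helper file (`--supports stmt-AtomisticToContinuum-9518`; registered stub `abs_Jfun_sub_Jfun_le`) of the line lead
(gen 1, seat c5), continuing `…FluxFormKinematics` (pair kinematics, calculus along lines on `𝕋³`) and
`…FluxForm` (the collision-by-collision bookkeeping on a good orbit).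

* `abs_sub_le_of_partialDeriv_le` — THE FIRST-ORDER TAYLOR STEP along the contact segment: for a `C¹` scalar
  `f` on `𝕋³` with `|∂_b f| ≤ C₁`, `|f(x + proj n) − f(x)| ≤ C₁ Σ_a |n_a|` (mean value theorem on
  `θ ↦ f(x + proj(θ n))`, whose derivative is `Σ_a n_a ∂_a f`);
* `abs_pairJump_le` — THE ONE-COLLISION ESTIMATE: for an ordered pair at contact (`‖x_i − x_j‖ = ε_N`,
  `0 < ε_N < 1/2`), slices `ψ s`, `χ s` smooth with gradients bounded by `C₁`:
  `|jumpK ij + jumpK ji| ≤ 12 C₁ · virialK ij` (`virialK = ε_N ‖Δv_i‖ (1 + ‖v_i‖ + ‖v_j‖)`), from the pair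
  identity `jumpK ij + jumpK ji = ⟪g, ω⟫ (⟪ψ(x_i) − ψ(x_j), ω⟫ + (χ(x_i) − χ(x_j)) ⟪V, ω⟫)`, `‖Δv_i‖ = |⟪g, ω⟫|`,
  `|ψ_a(x_i) − ψ_a(x_j)|, |χ(x_i) − χ(x_j)| ≤ 3 ε_N C₁` and `|⟪V, ω⟫| ≤ ‖v_i‖ + ‖v_j‖`;
* `abs_collisionPairSum_jumpK_le` — the window form on a good orbit: over the collision times in `(τ, τ']`,
  `0 ≤ τ`, `τ' ≤ t`, `|Σ jumpK| ≤ 12 C₁ Σ virialK` (binary collisions, the two orders of each colliding pair);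
* `collisionPairSum_Ioc_split` — additivity of the flow's collision pair sums over `(0, τ] ∪ (τ, τ'] = (0, τ']`;
* `abs_Jfun_sub_Jfun_le` (registered) — THE JUMP-SUM OSCILLATION BOUND:
  `|J_N(z, τ') − J_N(z, τ)| ≤ 12 C₁ (V_N(z, τ') − V_N(z, τ))` for `0 ≤ τ ≤ τ' ≤ t` on the good set — the
  deterministic input of the `sup_τ` step (grid in `τ` + monotone virial) of the line.
References: Spohn (1991) Part I §3.2; Chapman–Cowling (1970) §16.4 (collisional transfer across the contact).
-/

namespace Summit.AtomisticToContinuum.HydrodynamicLimit.Theorems.HemisphereAffineSlaving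

open scoped BigOperators Topology Classical ENNReal InnerProductSpace
open Filter Set Function MeasureTheory
open Literature.Analysis.FunctionSpaces Literature.Analysis.FluidPDE

noncomputable section

open Literature.MathematicalPhysics.KineticTheory (T3 V3 hsDiameter hsDiameter_pos)

/-! ## The first-order Taylor step and the one-collision estimate -/

section OneCollision

/-- **First-order Taylor step along a line on `𝕋³`.** If all first partial derivatives of the `C¹`
scalar `f` are bounded by `C₁`, then `|f(x + proj n) − f(x)| ≤ C₁ Σ_a |n_a|` (mean value theorem for
`θ ↦ f(x + proj(θ n))` on `[0, 1]`, derivative `Σ_a n_a ∂_a f`). -/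
theorem abs_sub_le_of_partialDeriv_le {f : T3 → ℝ} (hf : Torus.IsContDiff 1 f) {C₁ : ℝ}
    (hC : ∀ b y, |Torus.partialDeriv b f y| ≤ C₁) (x : T3) (n : V3) :
    |f (x + Torus.proj n) - f x| ≤ C₁ * ∑ a, |n a| := by
  set g : ℝ → ℝ := fun θ => f (x + Torus.proj (θ • n)) with hg
  have hgd : ∀ θ, HasDerivAt g (∑ a, n a * Torus.partialDeriv a f (x + Torus.proj (θ • n))) θ :=
    fun θ => hasDerivAt_lineMap_sum hf x n θ
  have hbound : ∀ θ ∈ Ico (0 : ℝ) 1,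
      ‖∑ a, n a * Torus.partialDeriv a f (x + Torus.proj (θ • n))‖ ≤ C₁ * ∑ a, |n a| := by
    intro θ _
    rw [Real.norm_eq_abs, Finset.mul_sum]
    refine (Finset.abs_sum_le_sum_abs _ _).trans (Finset.sum_le_sum fun a _ => ?_)
    rw [abs_mul, mul_comm]
    exact mul_le_mul_of_nonneg_right (hC a _) (abs_nonneg _)
  have h := norm_image_sub_le_of_norm_deriv_le_segment_01' (f := g)
    (fun θ _ => (hgd θ).hasDerivWithinAt) hbound
  have hg1 : g 1 = f (x + Torus.proj n) := by simp [hg]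
  have hg0 : g 0 = f x := by simp [hg]
  rw [Real.norm_eq_abs, hg1, hg0] at h
  exact h

/-- **The one-collision estimate.** For an ordered pair `(i, j)` at contact (`‖x_i − x_j‖ = ε_N`,
`0 < ε_N < 1/2`), with the slices `ψ s` (componentwise), `χ s` smooth and their gradients bounded by `C₁`:
the jump of the PAIR is at most `12 C₁` times the pair's weighted virial kernel
`ε_N ‖Δv_i‖ (1 + ‖v_i‖ + ‖v_j‖)` (pair identity `jumpK_add_jumpK_swap`, `‖Δv_i‖ = |⟪g, ω⟫|`, first-order
Taylor step across the contact; the constant `12` keeps the slack of `9`). -/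
theorem abs_pairJump_le {σ : ℝ} {N : ℕ} {w : Cfg N} {i j : Fin (N + 1)}
    (hcontact : ‖sepV N w i j‖ = hsDiameter σ N) (hεpos : 0 < hsDiameter σ N)
    (hεhalf : hsDiameter σ N < 2⁻¹)
    {ψ : ℝ → T3 → V3} {χ : ℝ → T3 → ℝ} {s : ℝ} (hψ : ∀ a, Torus.IsSmooth fun y => ψ s y a)
    (hχ : Torus.IsSmooth (χ s)) {C₁ : ℝ}
    (hCψ : ∀ a b y, |gradPsi ψ s y a b| ≤ C₁) (hCχ : ∀ y a, |gradChi χ s y a| ≤ C₁) :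
    |jumpK ψ χ N s w i j + jumpK ψ χ N s w j i| ≤ 12 * C₁ * virialK σ N s w i j := by
  set ε : ℝ := hsDiameter σ N with hεdef
  set n : V3 := sepV N w i j with hndef
  have hlt : ‖sepV N w i j‖ < 2⁻¹ := by rw [hcontact]; exact hεhalf
  have hn0 : n ≠ 0 := by
    intro h; rw [h, norm_zero] at hcontact; exact hεpos.ne hcontact
  have hC0 : 0 ≤ C₁ := (abs_nonneg _).trans (hCχ (w i).1 0)
  -- `C¹` slices and first-partial-derivative bounds
  have hψ1 : ∀ a, Torus.IsContDiff 1 fun y => ψ s y a := fun a => (hψ a).isContDiff (by simp)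
  have hχ1 : Torus.IsContDiff 1 (χ s) := hχ.isContDiff (by simp)
  have hCψ' : ∀ a b y, |Torus.partialDeriv b (fun y => ψ s y a) y| ≤ C₁ := by
    intro a b y
    have h := hCψ a b y
    rwa [gradPsi, gradient_apply_eq_partialDeriv (hψ1 a)] at h
  have hCχ' : ∀ b y, |Torus.partialDeriv b (χ s) y| ≤ C₁ := by
    intro b y
    have h := hCχ y b
    rwa [gradChi, gradient_apply_eq_partialDeriv hχ1] at h
  -- positions and the contact segment
  have hx : (w i).1 = (w j).1 + Torus.proj n := fst_eq_fst_add_proj_sepV w i j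
  set S : ℝ := ∑ a, |n a| with hSdef
  have hS0 : 0 ≤ S := Finset.sum_nonneg fun a _ => abs_nonneg _
  have hS3 : S ≤ 3 * ε := by rw [hSdef, ← hcontact]; exact sum_abs_le_three_mul_norm n
  -- finite differences of the tests across the contact
  have hdψ : ∀ a, |ψ s (w i).1 a - ψ s (w j).1 a| ≤ C₁ * S := by
    intro a
    rw [hx]
    exact abs_sub_le_of_partialDeriv_le (hψ1 a) (hCψ' a) (w j).1 n
  have hdχ : |χ s (w i).1 - χ s (w j).1| ≤ C₁ * S := by
    rw [hx]
    exact abs_sub_le_of_partialDeriv_le hχ1 hCχ' (w j).1 n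
  -- the unit normal and the flux weight
  have hω1 : ‖omg N w i j‖ = 1 := norm_omg hn0
  set c : ℝ := ⟪(w i).2 - (w j).2, omg N w i j⟫_ℝ with hcdef
  have hdv : ‖dV N w i j‖ = |c| := norm_dV_eq hn0
  -- bounds of the three factors
  have hV : |⟪Vcm N w i j, omg N w i j⟫_ℝ| ≤ ‖(w i).2‖ + ‖(w j).2‖ := by
    calc |⟪Vcm N w i j, omg N w i j⟫_ℝ| ≤ ‖Vcm N w i j‖ * ‖omg N w i j‖ := abs_real_inner_le_norm _ _
      _ = ‖Vcm N w i j‖ := by rw [hω1, mul_one]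
      _ ≤ 1 / 2 * (‖(w i).2‖ + ‖(w j).2‖) := by
          rw [Vcm, norm_smul, Real.norm_eq_abs, abs_of_pos (by norm_num : (0 : ℝ) < 1 / 2)]
          exact mul_le_mul_of_nonneg_left (norm_add_le _ _) (by norm_num)
      _ ≤ ‖(w i).2‖ + ‖(w j).2‖ := by linarith [norm_nonneg (w i).2, norm_nonneg (w j).2]
  have hωa : ∀ a, |omg N w i j a| ≤ 1 := fun a => by
    rw [← Real.norm_eq_abs]
    exact (PiLp.norm_apply_le (omg N w i j) a).trans_eq hω1
  have hψω : |⟪ψ s (w i).1 - ψ s (w j).1, omg N w i j⟫_ℝ| ≤ 3 * (C₁ * S) := by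
    have hinner : ⟪ψ s (w i).1 - ψ s (w j).1, omg N w i j⟫_ℝ =
        ∑ a, omg N w i j a * (ψ s (w i).1 a - ψ s (w j).1 a) := by
      simp only [PiLp.inner_apply, PiLp.sub_apply, RCLike.inner_apply, conj_trivial]
    rw [hinner]
    calc |∑ a, omg N w i j a * (ψ s (w i).1 a - ψ s (w j).1 a)|
        ≤ ∑ a, |omg N w i j a * (ψ s (w i).1 a - ψ s (w j).1 a)| := Finset.abs_sum_le_sum_abs _ _
      _ ≤ ∑ _a : Fin 3, C₁ * S := Finset.sum_le_sum fun a _ => by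
          rw [abs_mul]
          calc |omg N w i j a| * |ψ s (w i).1 a - ψ s (w j).1 a| ≤ 1 * (C₁ * S) :=
                mul_le_mul (hωa a) (hdψ a) (abs_nonneg _) zero_le_one
            _ = C₁ * S := one_mul _
      _ = 3 * (C₁ * S) := by simp
  have hin : |⟪ψ s (w i).1 - ψ s (w j).1, omg N w i j⟫_ℝ +
      (χ s (w i).1 - χ s (w j).1) * ⟪Vcm N w i j, omg N w i j⟫_ℝ| ≤
      3 * (C₁ * S) + C₁ * S * (‖(w i).2‖ + ‖(w j).2‖) := by
    refine (abs_add_le _ _).trans (add_le_add hψω ?_)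
    rw [abs_mul]
    exact mul_le_mul hdχ hV (abs_nonneg _) (by positivity)
  -- assemble
  rw [jumpK_add_jumpK_swap hlt, ← hcdef, abs_mul, virialK, hdv, ← hεdef]
  calc |c| * |⟪ψ s (w i).1 - ψ s (w j).1, omg N w i j⟫_ℝ +
        (χ s (w i).1 - χ s (w j).1) * ⟪Vcm N w i j, omg N w i j⟫_ℝ|
      ≤ |c| * (3 * (C₁ * S) + C₁ * S * (‖(w i).2‖ + ‖(w j).2‖)) :=
        mul_le_mul_of_nonneg_left hin (abs_nonneg c)
    _ ≤ |c| * (3 * (C₁ * (3 * ε)) + C₁ * (3 * ε) * (‖(w i).2‖ + ‖(w j).2‖)) := by gcongr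
    _ = (9 + 3 * (‖(w i).2‖ + ‖(w j).2‖)) * (C₁ * (ε * |c|)) := by ring
    _ ≤ (12 * (1 + ‖(w i).2‖ + ‖(w j).2‖)) * (C₁ * (ε * |c|)) := by
        refine mul_le_mul_of_nonneg_right ?_ (by positivity)
        linarith [norm_nonneg (w i).2, norm_nonneg (w j).2]
    _ = 12 * C₁ * (ε * |c| * (1 + ‖(w i).2‖ + ‖(w j).2‖)) := by ring

end OneCollision

/-! ## Summation over the collisions of a good orbit in a window `(τ, τ']` -/

section Orbit

/-- **The window form on a good orbit.** For `0 < σ ≤ 1/2`, a flow family, a good initial datum, tests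
whose slices on `[0, t]` are smooth with gradients bounded by `C₁ ≥ 0`, and a window `(τ, τ']` with
`0 ≤ τ`, `τ' ≤ t`: the collision pair sum of the jump kernel over the window is at most `12 C₁` times that
of the weighted virial kernel (binary collisions; the two orders of each colliding pair are grouped and
`abs_pairJump_le` is applied pair by pair, the partner's virial kernel being nonnegative). -/
theorem abs_collisionPairSum_jumpK_le {σ : ℝ} (hσ : 0 < σ) (hσ2 : σ ≤ 1 / 2) (Φ : Flows σ) {N : ℕ}
    {z : Cfg N} (hz : z ∈ (Φ N).good) {t : ℝ} {ψ : ℝ → T3 → V3} {χ : ℝ → T3 → ℝ} {C₁ : ℝ}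
    (hC₁ : 0 ≤ C₁) (hψ : ∀ s ∈ Icc 0 t, ∀ a, Torus.IsSmooth fun y => ψ s y a)
    (hχ : ∀ s ∈ Icc 0 t, Torus.IsSmooth (χ s))
    (hCψ : ∀ s ∈ Icc 0 t, ∀ a b y, |gradPsi ψ s y a b| ≤ C₁)
    (hCχ : ∀ s ∈ Icc 0 t, ∀ y a, |gradChi χ s y a| ≤ C₁) {τ τ' : ℝ} (hτ : 0 ≤ τ) (hτ't : τ' ≤ t) :
    |(Φ N).collisionPairSum (Ioc τ τ') (jumpK ψ χ N) z| ≤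
      12 * C₁ * (Φ N).collisionPairSum (Ioc τ τ') (virialK σ N) z := by
  have htraj := (Φ N).isTrajectory z hz
  have hfin := htraj.finite_collisionTimes_inter_Ioc τ τ'
  have hε := hsDiameter_pos hσ N
  unfold HardSphereFlow.collisionPairSum
  rw [collisionPairSum_eq_finset_sum hfin, collisionPairSum_eq_finset_sum hfin, Finset.mul_sum]
  refine (Finset.abs_sum_le_sum_abs _ _).trans (Finset.sum_le_sum fun tc htc => ?_)
  -- one collision time
  have htc' : tc ∈ collisionTimes (Torus.geometry (Fin 3)) (hsDiameter σ N) (fun s => (Φ N).flow s z) ∧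
      tc ∈ Ioc τ τ' := (Set.Finite.mem_toFinset hfin).1 htc
  obtain ⟨⟨p, q, hpq, hcs⟩, htcI⟩ := htc'
  have hs : tc ∈ Icc 0 t := ⟨hτ.trans htcI.1.le, htcI.2.trans hτ't⟩
  -- at least two particles, so `ε_N < 1/2`
  have hN : 1 ≤ N := by
    rcases Nat.eq_zero_or_pos N with h0 | h0
    · subst h0; exact absurd (Fin.ext (by omega)) hpq
    · exact h0
  have hεhalf := hsDiameter_lt_half hσ hσ2 hN
  -- the two ordered contact pairs
  set w : Cfg N := (Φ N).flow tc z with hw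
  have hpq_mem : (p, q) ∈ contactPairs (Torus.geometry (Fin 3)) (hsDiameter σ N) w :=
    mem_contactPairs.2 ⟨hpq, hcs⟩
  have hqp_mem : (q, p) ∈ contactPairs (Torus.geometry (Fin 3)) (hsDiameter σ N) w := by
    refine mem_contactPairs.2 ⟨Ne.symm hpq, hcs.1, ?_⟩
    rw [Torus.norm_geometry_sepVec, Torus.euclidDist_comm, ← Torus.norm_geometry_sepVec]
    exact hcs.2
  have hpairs : contactPairs (Torus.geometry (Fin 3)) (hsDiameter σ N) w = {(p, q), (q, p)} := by
    ext e
    rw [Finset.mem_insert, Finset.mem_singleton]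
    exact ⟨htraj.eq_or_eq_of_mem_contactPairs hpq_mem, by rintro (rfl | rfl) <;> assumption⟩
  have hne : (p, q) ≠ (q, p) := fun he => hpq (Prod.mk.inj he).1
  rw [hpairs, Finset.sum_pair hne, Finset.sum_pair hne]
  -- the one-collision estimate at this collision
  have hcontact : ‖sepV N w p q‖ = hsDiameter σ N := hcs.2
  have hstep := abs_pairJump_le hcontact hε hεhalf (hψ tc hs) (hχ tc hs) (hCψ tc hs) (hCχ tc hs)
  refine hstep.trans ?_
  rw [mul_add]
  exact le_add_of_nonneg_right
    (mul_nonneg (mul_nonneg (by norm_num) hC₁) (virialK_nonneg hσ.le N tc w q p))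

/-- Additivity of the flow's collision pair sums in the window: `(0, τ'] = (0, τ] ∪ (τ, τ']` for
`0 ≤ τ ≤ τ'` on a good orbit (finitely many collision times in each bounded window). -/
theorem collisionPairSum_Ioc_split {σ : ℝ} (Φ : Flows σ) {N : ℕ} {z : Cfg N} (hz : z ∈ (Φ N).good)
    {τ τ' : ℝ} (hτ : 0 ≤ τ) (hττ' : τ ≤ τ') (g : ℝ → Cfg N → Fin (N + 1) → Fin (N + 1) → ℝ) :
    (Φ N).collisionPairSum (Ioc 0 τ') g z =
      (Φ N).collisionPairSum (Ioc 0 τ) g z + (Φ N).collisionPairSum (Ioc τ τ') g z := by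
  have htraj := (Φ N).isTrajectory z hz
  unfold HardSphereFlow.collisionPairSum
  rw [← Ioc_union_Ioc_eq_Ioc hτ hττ']
  exact collisionPairSum_union (htraj.finite_collisionTimes_inter_Ioc _ _)
    (htraj.finite_collisionTimes_inter_Ioc _ _) (Ioc_disjoint_Ioc_of_le le_rfl) _

end Orbit

/-! ## The registered stub -/

/-- **Registered stub `abs_Jfun_sub_Jfun_le` — THE JUMP-SUM OSCILLATION IS DOMINATED BY THE VIRIAL
INCREMENTS.** For `0 < σ ≤ 1/2`, a flow family, a good initial datum, tests whose slices on `[0, t]` are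
smooth (componentwise for `ψ`) with gradients bounded by `C₁ ≥ 0`, and `0 ≤ τ ≤ τ' ≤ t`:
`|J_N(z, τ') − J_N(z, τ)| ≤ 12 C₁ (V_N(z, τ') − V_N(z, τ))` — both differences are the normalised collision
pair sums over the window `(τ, τ']`, and collision by collision the jump of the colliding pair
`⟪g, ω⟫ (⟪ψ(x_i) − ψ(x_j), ω⟫ + (χ(x_i) − χ(x_j)) ⟪V, ω⟫)` is at most `12 C₁ ε_N ‖Δv_i‖ (1 + ‖v_i‖ + ‖v_j‖)` by
the first-order Taylor step across the contact `‖x_i − x_j‖ = ε_N`. [folklore; Spohn (1991) I §3.2] -/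
theorem abs_Jfun_sub_Jfun_le : ∀ {σ : ℝ}, 0 < σ → σ ≤ 1 / 2 → ∀ (Φ : Flows σ) {N : ℕ} {z : Cfg N}, z ∈ (Φ N).good → ∀ {t : ℝ} {ψ : ℝ → T3 → V3} {χ : ℝ → T3 → ℝ} {C₁ : ℝ}, 0 ≤ C₁ → (∀ s ∈ Icc 0 t, ∀ a, Literature.Analysis.FunctionSpaces.Torus.IsSmooth fun y => ψ s y a) → (∀ s ∈ Icc 0 t, Literature.Analysis.FunctionSpaces.Torus.IsSmooth (χ s)) → (∀ s ∈ Icc 0 t, ∀ a b y, |gradPsi ψ s y a b| ≤ C₁) → (∀ s ∈ Icc 0 t, ∀ y a, |gradChi χ s y a| ≤ C₁) → ∀ {τ τ' : ℝ}, 0 ≤ τ → τ ≤ τ' → τ' ≤ t → |Jfun σ Φ ψ χ N z τ' - Jfun σ Φ ψ χ N z τ| ≤ 12 * C₁ * (virialW σ Φ N z τ' - virialW σ Φ N z τ) := by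
  intro σ hσ hσ2 Φ N z hz t ψ χ C₁ hC₁ hψ hχ hCψ hCχ τ τ' hτ hττ' hτ't
  set c : ℝ := ((N : ℝ) + 1)⁻¹ with hcdef
  have hc0 : 0 ≤ c := by positivity
  have hJ : Jfun σ Φ ψ χ N z τ' - Jfun σ Φ ψ χ N z τ =
      c * (Φ N).collisionPairSum (Ioc τ τ') (jumpK ψ χ N) z := by
    unfold Jfun
    rw [collisionPairSum_Ioc_split Φ hz hτ hττ', ← hcdef]
    ring
  have hV : virialW σ Φ N z τ' - virialW σ Φ N z τ =
      c * (Φ N).collisionPairSum (Ioc τ τ') (virialK σ N) z := by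
    unfold virialW
    rw [collisionPairSum_Ioc_split Φ hz hτ hττ', ← hcdef]
    ring
  rw [hJ, hV, abs_mul, abs_of_nonneg hc0, mul_left_comm (12 * C₁) c]
  exact mul_le_mul_of_nonneg_left
    (abs_collisionPairSum_jumpK_le hσ hσ2 Φ hz hC₁ hψ hχ hCψ hCχ hτ hτ't) hc0

end

end Summit.AtomisticToContinuum.HydrodynamicLimit.Theorems.HemisphereAffineSlaving
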